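import Summits.ValiantsHypothesis.ValiantsHypothesis.Theorems.SymPencilSingSixClassificationDefs
import Literature.Barriers.CriticalPhenomena.SAPColumnClasses

/-!
# Route `SymPencil` — SING-SIX CLASSIFICATION, Theorem A (T6′): every `6`-dimensional linear
# subspace of `Sing Z(per₄)` lies in a cross, has two zero rows / columns, or is an exotic
# one-zero-line family `V_λ`, `V^gr` (ᵀ) — VERBATIM port, part 2/10 (`--supports`
# stmt-ValiantsHypothesis-5674 `SdcSuperquadratic`; rung currency only, nothing here bears on `VP ≠ VNP`)

PORT NOTE (val-width-5674-w2 g0′, helper mode; director-valiant R223 (a)): part 2/10 of a VERBATIM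
port of val-idea-18 g3/g4's SORRY-FREE Theorem A of `Cruxes/SdcSuperquadratic/Lines/
sing_six_classification.lean` rev 2.6 (sha256 dfb5f805c61d14b7…; here: `PureCore` … `finrank_kerPlane`).
ALL mathematics and proofs are val-idea-18's (memo `SING-SIX-CLASSIFICATION.md`); the port changes
only the file split, the linear import chain, the namespace, and one-line docstrings on API lemmas.
NOT ported: the `sorry`-stubs of LIST leaves 3–5 and `sixDim_perDir_list` (leaves 3, 4 = landed
`SymPencilPerFourExoticNoSixSquares` / `SymPencilPerFourCrossFilter`; leaf 5 open).
  Cut table: see part 1 (`…Defs`).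
Honest label: Theorem A of a line, not the crux, not the LIST; `27 ≤ sdc(per₄) ≤ 29` unchanged; stmt-5674
open; `VP ≠ VNP` not moved; no summit statement is proved here. [folklore]
-/

noncomputable section
set_option linter.dupNamespace false
set_option linter.unusedVariables false
set_option linter.unusedSectionVars false

namespace Summit.ValiantsHypothesis.ValiantsHypothesis.Theorems.SymPencilSingSixClassification

open MvPolynomial Module Literature.Computability.AlgebraicComplexity
open Literature.Barriers.CriticalPhenomena.Haruspicy (fin4_cases)
variable {K : Type*} [Field K]

/-- **PURE-PLANE CORE** (PROVED rev 2.4 as `pureCore`; also `= SBShape + LemmaPhi`, `pureCore_of`):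
a linear `φ` with `P(u, φu) B = 0` for all `u` and a `≥ 2`-dimensional `B` vanishes. [folklore] -/
def PureCore (K : Type*) [Field K] : Prop :=
  ∀ (φ : (Fin 4 → K) →ₗ[K] (Fin 4 → K)) (B : Submodule K (Fin 4 → K)), 2 ≤ finrank K B →
    (∀ u, ∀ b ∈ B, ∀ l, T3 u (φ u) b l = 0) → φ = 0

/-- **§3.5 / C12 PRODUCT ABSORPTION** (M).  For `a = αe_j + βe_c ≠ 0` and `b = αe_j − βe_c`:
a linear `χ` with `P(u, a) χ(u) = 0` for all `u` takes values in `K b`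
(`ker P(a,u) = K b` for generic `u`, memo §3.5; also for `αβ = 0`).  [Checks C6, C12, C12′.] [folklore] -/
def ProductAbsorb (K : Type*) [Field K] : Prop :=
  ∀ (j c : Fin 4) (α β : K) (χ : (Fin 4 → K) →ₗ[K] (Fin 4 → K)), j ≠ c → (α ≠ 0 ∨ β ≠ 0) →
    (∀ u l, T3 u (lvec j c α β) (χ u) l = 0) → ∀ u, ∃ μ : K, χ u = μ • lvec j c α (-β)

/-- **C13 GRAPH ABSORPTION** (M).  For `e ≠ 0` and linear `φ, χ` with
`P(u, v) χ(u) + e · P(u, σv) φ(u) = 0` for all `u` and all `v ∈ span(e_j, e_c)` (`σ` = sign flip at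
`c`): `φ` takes values in `span(e_j, e_c)` and `χ = e · σ ∘ φ`.  [Checks C13, C13′.] [folklore] -/
def GraphAbsorb (K : Type*) [Field K] : Prop :=
  ∀ (j c : Fin 4) (e : K) (φ χ : (Fin 4 → K) →ₗ[K] (Fin 4 → K)), j ≠ c → e ≠ 0 →
    (∀ u v : Fin 4 → K, (∀ i, i ≠ j → i ≠ c → v i = 0) → ∀ l,
        T3 u v (χ u) l + e * T3 u (flipAt c v) (φ u) l = 0) →
    ∀ u, (∀ i, i ≠ j → i ≠ c → φ u i = 0) ∧ χ u = e • flipAt c (φ u)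

/-- **§3.8 TORIC TRIPLE LEMMA** (PROVED rev 2.5 as `toricTriple : PermOrthPairs → ToricTriple`, without
the memo's shapes C1–C3′ / `SBShape`).  Three `2`-planes `A₁, A₂, A₃ ⊆ K⁴` with `T3 (a₁, a₂, a₃) = 0`
identically (i.e. `P(a₂,a₃) A₁ = 0`) have two common zero coordinates `p ≠ q` (in fact
`A₁ = A₂ = A₃ = span(e_r, e_s)`).  Proof: the symmetric zero-diagonal matrices killing the `2`-plane
`A₁` form a LINE (kernel-pair lemma `smallKer`), so for each `a₃` the plane `{P(a₂,a₃) : a₂ ∈ A₂}`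
contains `0`: a perpendicular partner; by `PermOrthPairs` every `a₃` sits on a coordinate pair, by a
finite-union argument `A₃` on ONE pair, so `e_j ∈ A₃`, and a coordinate vector propagates
(`toric_caseI`).  [Check C9: exhaustive over `F₅`.] [folklore] -/
def ToricTriple (K : Type*) [Field K] : Prop :=
  ∀ A₁ A₂ A₃ : Submodule K (Fin 4 → K), finrank K A₁ = 2 → finrank K A₂ = 2 → finrank K A₃ = 2 →
    (∀ a₁ ∈ A₁, ∀ a₂ ∈ A₂, ∀ a₃ ∈ A₃, ∀ l, T3 a₁ a₂ a₃ l = 0) →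
    ∃ p q : Fin 4, p ≠ q ∧ (∀ a ∈ A₁, a p = 0 ∧ a q = 0) ∧ (∀ a ∈ A₂, a p = 0 ∧ a q = 0) ∧
      (∀ a ∈ A₃, a p = 0 ∧ a q = 0)

/-! ### Case statements (`W`-level; `r, s, t = ρ 1, ρ 2, ρ 3`, `ρ 0 = 0` the zero row) -/

/-- **§3.6 (i) PURE KERNEL PLANE** (M given `PureCore`).  If `n_r = 4` and row `s` vanishes on
`K_r = W ∩ {row r = 0}`, then row `s` vanishes on all of `W` (so `W` has the two zero rows `0, s`).
Proof: choose a linear section `u ↦ (0; u; φu; χu)` of `row_r : W → K⁴`; `B := row_t (K_r)` is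
`2`-dimensional; `T3 (u, φu, b) = 0` for `b ∈ B` (the `t¹`-coefficient of `Sing` along `x + t k`,
`k = (0;0;0;b) ∈ K_r`); `PureCore` gives `φ = 0`; `W = section + K_r`. [folklore] -/
def CasePure (K : Type*) [Field K] : Prop :=
  ∀ (W : Submodule K (Fin 4 × Fin 4 → K)) (ρ : Equiv.Perm (Fin 4)), NormSix W → ρ 0 = 0 →
    W.map (rowL (ρ 1)) = ⊤ → (∀ k ∈ W, row k (ρ 1) = 0 → row k (ρ 2) = 0) →
    ∀ x ∈ W, row x (ρ 2) = 0

/-- **§3.6 (ii) PRODUCT KERNEL PLANE** (M given `ProductAbsorb`).  If `n_r = 4` and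
`K_r = {(0; 0; μa; νb)}` with `a = αe_j+βe_c`, `b = αe_j−βe_c`, then `W = {(0; u; μa; νb)}`:
for `αβ ≠ 0` this is `V_λ` (`VLambdaRows`), for `αβ = 0` it lies in the cross `X_{r j'}` (`InCross`).
Proof: section `(0;u;φu;χu)`; the `t¹`-coefficients of `Sing` along `K_r` give
`P(u,a)χ(u) = 0 = P(u,b)φ(u)`; `ProductAbsorb` (and its `β ↦ -β` instance) puts `χu ∈ Kb`, `φu ∈ Ka`,
which are absorbed into `K_r`; dimension count `4 + 2 = 6`. [folklore] -/
def CaseProduct (K : Type*) [Field K] : Prop :=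
  ∀ (W : Submodule K (Fin 4 × Fin 4 → K)) (ρ : Equiv.Perm (Fin 4)) (j c : Fin 4) (α β : K),
    NormSix W → ρ 0 = 0 → W.map (rowL (ρ 1)) = ⊤ → j ≠ c → (α ≠ 0 ∨ β ≠ 0) →
    (∀ k, k ∈ W ∧ row k (ρ 1) = 0 ↔
      ((∀ i, i ≠ ρ 2 → i ≠ ρ 3 → row k i = 0) ∧
        (∃ μ : K, row k (ρ 2) = μ • lvec j c α β) ∧ (∃ ν : K, row k (ρ 3) = ν • lvec j c α (-β)))) →
    VLambdaRows W ∨ InCross W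

/-- **§3.6 (iii) GRAPH KERNEL PLANE** (M given `GraphAbsorb`).  If `n_r = 4` and `K_r` is the graph
plane `Γ_e` on `(j, c)`, then `W = {(0; u; v; e·σv) : v ∈ span(e_j,e_c)} = V^gr` (`VGraphRows`, with
`γ 0 = j`, `γ 1 = c`, `c₀ = e`).  Proof: section; the `t¹`-coefficient of `Sing` along `K_r` is the
hypothesis of `GraphAbsorb`; absorb `(0;0;φu;χu) ∈ K_r`; dimension count. [folklore] -/
def CaseGraph (K : Type*) [Field K] : Prop :=
  ∀ (W : Submodule K (Fin 4 × Fin 4 → K)) (ρ : Equiv.Perm (Fin 4)) (j c : Fin 4) (e : K),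
    NormSix W → ρ 0 = 0 → W.map (rowL (ρ 1)) = ⊤ → j ≠ c → e ≠ 0 →
    (∀ k, k ∈ W ∧ row k (ρ 1) = 0 ↔
      ((∀ i, i ≠ ρ 2 → i ≠ ρ 3 → row k i = 0) ∧
        (∀ i, i ≠ j → i ≠ c → k (ρ 2, i) = 0 ∧ k (ρ 3, i) = 0) ∧
        k (ρ 3, j) = e * k (ρ 2, j) ∧ k (ρ 3, c) = -(e * k (ρ 2, c)))) →
    VGraphRows W

/-- **CASE `n_r = 4`** (assembled from the kernel-plane types and the three sub-cases by `caseFour_of`,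
PROVED). [folklore] -/
def CaseFour (K : Type*) [Field K] : Prop :=
  ∀ (W : Submodule K (Fin 4 × Fin 4 → K)) (ρ : Equiv.Perm (Fin 4)), NormSix W → ρ 0 = 0 →
    W.map (rowL (ρ 1)) = ⊤ → Concl W

/-- **§3.7 CASE `max n_r = 3`** (M given `PerpPlanes`; uses `polar`).  If every live `n_i ≤ 3` and
`n_r = 3`, then two rows vanish on `W`.  Proof: `K_r` is `3`-dimensional and `A_r` (a hyperplane) lies in
`ker P(v', w')` for `(v', w') ∈ K_r`, so `rank P(v',w') ≤ 1`, hence `P = 0` (zero-diagonal symmetric):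
`K_r` consists of perm-orthogonal pairs and `PerpPlanes` (dim `3`) makes it PURE, say row `s ≡ 0` on
`K_r`, row `t` injective on `K_r`; then `n_t = 3`, `K_t` is pure too, and either row `s ≡ 0` on
`W = K_r ⊕ K_t`, or `K_t ⊆ K_r` contradicts `dim K_t = 3`. [folklore] -/
def CaseThree (K : Type*) [Field K] : Prop :=
  ∀ (W : Submodule K (Fin 4 × Fin 4 → K)) (ρ : Equiv.Perm (Fin 4)), NormSix W → ρ 0 = 0 →
    (∀ i, i ≠ 0 → finrank K (W.map (rowL i)) ≤ 3) → finrank K (W.map (rowL (ρ 1))) = 3 →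
    TwoZeroRows W

/-- **§3.8 TORIC PRODUCT STRUCTURE** (S; pure linear algebra, no `Sing`).  If `dim W = 6`, row `0`
vanishes on `W` and every live `n_i ≤ 2`, then every live `n_i = 2` and
`W = {x : row₀ x = 0, rowᵢ x ∈ Aᵢ}` is the full product of its three row spaces
(`W ↪ A₁ × A₂ × A₃` and `6 ≤ n₁ + n₂ + n₃ ≤ 6`). [folklore] -/
def ToricStructure (K : Type*) [Field K] : Prop :=
  ∀ W : Submodule K (Fin 4 × Fin 4 → K), finrank K W = 6 → (∀ x ∈ W, row x 0 = 0) →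
    (∀ i, i ≠ 0 → finrank K (W.map (rowL i)) ≤ 2) →
    (∀ i, i ≠ 0 → finrank K (W.map (rowL i)) = 2) ∧
      ∀ x : Fin 4 × Fin 4 → K, row x 0 = 0 → (∀ i, i ≠ 0 → row x i ∈ W.map (rowL i)) → x ∈ W

/-- The normal-form residue theorem: `NormSix W → Concl W` (`residueNorm_of`, PROVED from the cases). -/
def ResidueNorm (K : Type*) [Field K] : Prop :=
  ∀ W : Submodule K (Fin 4 × Fin 4 → K), NormSix W → Concl W

/-- **SYMMETRY TRANSPORT** (S/M; bookkeeping).  `Sing3` is invariant under row permutations and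
transposition (`Matrix.permanent_permute_rows/cols`, `Matrix.permanent_transpose`; `Sing3` quantifies
over ALL injective row/column selections), `finrank` is preserved by the linear equivalences
`x ↦ x ∘ (σ × id)` / `x ↦ xᵀ`, and the seven predicates of `Concl` are permuted among themselves
(rows ↔ cols under ᵀ; the index data `ρ, γ, l, c, p, q` are composed with `σ`).  So the normal form
(the zero row moved to row `0`; a zero column first transposed to a zero row) suffices. [folklore] -/
def Transport (K : Type*) [Field K] : Prop :=
  ResidueNorm K → ∀ W : Submodule K (Fin 4 × Fin 4 → K), Sing3 W → finrank K W = 6 →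
    ((∃ i : Fin 4, ∀ x ∈ W, ∀ j : Fin 4, x (i, j) = 0) ∨
      (∃ j : Fin 4, ∀ x ∈ W, ∀ i : Fin 4, x (i, j) = 0)) → Concl W

/-! ### The residue cascade (rev 2.5: no stubs left — `permOrthPairs`, `transport` are proved here;
`toricStructure`, the tools and the four CASES further below) -/

/-- **§3.3 PERM-ORTHOGONAL PAIRS — PROVED** (rev 2.1; was `stub_permOrthPairs`). -/
theorem permOrthPairs [CharZero K] : PermOrthPairs K := by
  intro v w h
  by_cases hv : v = 0
  · exact Or.inl hv
  by_cases hw : w = 0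
  · exact Or.inr (Or.inl hw)
  refine Or.inr (Or.inr ?_)
  obtain ⟨p, hp⟩ : ∃ p, v p ≠ 0 := Function.ne_iff.mp hv
  obtain ⟨q₀, hq₀⟩ : ∃ q, w q ≠ 0 := Function.ne_iff.mp hw
  have hA : ∀ q, v q = 0 → w q = 0 := by
    intro q hq
    have hpq : p ≠ q := by rintro rfl; exact hp hq
    have e := h p q hpq
    simp only [pairPerm, hq, zero_mul, add_zero] at e
    exact (mul_eq_zero.mp e).resolve_left hp
  have hB : ∀ q, w q = 0 → v q = 0 := by
    intro q hq
    have hpq : q₀ ≠ q := by rintro rfl; exact hq₀ hq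
    have e := h q₀ q hpq
    simp only [pairPerm, hq, mul_zero, zero_add] at e
    exact (mul_eq_zero.mp e).resolve_right hq₀
  -- three nonzero coordinates are impossible (pairwise opposite ratios, char ≠ 2)
  have h3 : ∀ a b d : Fin 4, a ≠ b → a ≠ d → b ≠ d → v a ≠ 0 → v b ≠ 0 → v d ≠ 0 → False := by
    intro a b d hab had hbd ha hb hd
    have hwa : w a ≠ 0 := fun e => ha (hB a e)
    have e1 := h a b hab
    have e2 := h a d had
    have e3 := h b d hbd
    simp only [pairPerm] at e1 e2 e3
    have e4 : (2 : K) * (v b * (v d * w a)) = 0 := by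
      linear_combination v b * e2 + v d * e1 - v a * e3
    rcases mul_eq_zero.mp e4 with e5 | e5
    · exact two_ne_zero e5
    rcases mul_eq_zero.mp e5 with e6 | e6
    · exact hb e6
    rcases mul_eq_zero.mp e6 with e7 | e7
    · exact hd e7
    · exact hwa e7
  by_cases hex : ∃ c, c ≠ p ∧ v c ≠ 0
  · obtain ⟨c, hcp, hc⟩ := hex
    refine ⟨p, c, hcp.symm, fun i hip hic => ?_⟩
    have hvi : v i = 0 := by
      by_contra hvi
      exact h3 p c i hcp.symm hip.symm hic.symm hp hc hvi
    exact ⟨hvi, hA i hvi⟩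
  · push Not at hex
    obtain ⟨c, hcp⟩ := exists_ne p
    refine ⟨p, c, hcp.symm, fun i hip hic => ?_⟩
    have hvi : v i = 0 := hex i hip
    exact ⟨hvi, hA i hvi⟩

/-! #### Symmetry transport — PROVED (rev 2.1; was `stub_transport`) -/

/-- Row permutation `x ↦ ((i, j) ↦ x (σ i, j))` as a linear equivalence. -/
def rowPermL (σ : Equiv.Perm (Fin 4)) : (Fin 4 × Fin 4 → K) ≃ₗ[K] (Fin 4 × Fin 4 → K) :=
  LinearEquiv.funCongrLeft K K (Equiv.prodCongr σ (Equiv.refl (Fin 4)))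

/-- Auxiliary: `rowPermL_apply` (val-idea-18, SING-SIX classification). [folklore] -/
@[simp] theorem rowPermL_apply (σ : Equiv.Perm (Fin 4)) (x : Fin 4 × Fin 4 → K) (i j : Fin 4) :
    rowPermL σ x (i, j) = x (σ i, j) := rfl

/-- Transposition `x ↦ ((i, j) ↦ x (j, i))` as a linear equivalence. -/
def transposeL : (Fin 4 × Fin 4 → K) ≃ₗ[K] (Fin 4 × Fin 4 → K) :=
  LinearEquiv.funCongrLeft K K (Equiv.prodComm (Fin 4) (Fin 4))

/-- Auxiliary: `transposeL_apply` (val-idea-18, SING-SIX classification). [folklore] -/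
@[simp] theorem transposeL_apply (x : Fin 4 × Fin 4 → K) (i j : Fin 4) :
    transposeL (K := K) x (i, j) = x (j, i) := rfl

/-- Auxiliary: `mem_iff_map_equiv` (val-idea-18, SING-SIX classification). [folklore] -/
theorem mem_iff_map_equiv (e : (Fin 4 × Fin 4 → K) ≃ₗ[K] (Fin 4 × Fin 4 → K))
    (W : Submodule K (Fin 4 × Fin 4 → K)) (x : Fin 4 × Fin 4 → K) :
    x ∈ W ↔ e x ∈ W.map (e : (Fin 4 × Fin 4 → K) →ₗ[K] (Fin 4 × Fin 4 → K)) := by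
  rw [Submodule.mem_map_equiv, LinearEquiv.symm_apply_apply]

/-- Auxiliary: `sing3_map_rowPermL` (val-idea-18, SING-SIX classification). [folklore] -/
theorem sing3_map_rowPermL {W : Submodule K (Fin 4 × Fin 4 → K)} (hS : Sing3 W)
    (σ : Equiv.Perm (Fin 4)) :
    Sing3 (W.map (rowPermL (K := K) σ : (Fin 4 × Fin 4 → K) →ₗ[K] (Fin 4 × Fin 4 → K))) := by
  intro y hy r c hr hc
  obtain ⟨x, hx, rfl⟩ := Submodule.mem_map.mp hy
  have key : (Matrix.of fun i j => (rowPermL (K := K) σ : (Fin 4 × Fin 4 → K) →ₗ[K]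
      (Fin 4 × Fin 4 → K)) x (i, j)).submatrix r c =
      (Matrix.of fun i j => x (i, j)).submatrix (σ ∘ r) c := Matrix.ext fun _ _ => rfl
  rw [key]
  exact hS x hx _ _ (σ.injective.comp hr) hc

/-- Auxiliary: `sing3_map_transposeL` (val-idea-18, SING-SIX classification). [folklore] -/
theorem sing3_map_transposeL {W : Submodule K (Fin 4 × Fin 4 → K)} (hS : Sing3 W) :
    Sing3 (W.map (transposeL (K := K) : (Fin 4 × Fin 4 → K) →ₗ[K] (Fin 4 × Fin 4 → K))) := by
  intro y hy r c hr hc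
  obtain ⟨x, hx, rfl⟩ := Submodule.mem_map.mp hy
  have key : (Matrix.of fun i j => (transposeL (K := K) : (Fin 4 × Fin 4 → K) →ₗ[K]
      (Fin 4 × Fin 4 → K)) x (i, j)).submatrix r c =
      ((Matrix.of fun i j => x (i, j)).submatrix c r).transpose := Matrix.ext fun _ _ => rfl
  rw [key, Matrix.permanent_transpose]
  exact hS x hx _ _ hc hr

/-- `Concl` pulls back along a row permutation. -/
theorem concl_of_rowPerm (σ : Equiv.Perm (Fin 4)) {W W' : Submodule K (Fin 4 × Fin 4 → K)}
    (hmem : ∀ x, x ∈ W ↔ rowPermL σ x ∈ W') : Concl W' → Concl W := by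
  have hsy : ∀ i : Fin 4, σ (σ.symm i) = i := fun i => σ.apply_symm_apply i
  rintro (⟨l, c, h⟩ | ⟨p, q, hpq, h⟩ | ⟨p, q, hpq, h⟩ | ⟨ρ, γ, α, β, hα, hβ, h⟩ |
    ⟨ρ, γ, c₀, hc, h⟩ | ⟨ρ, γ, α, β, hα, hβ, h⟩ | ⟨ρ, γ, c₀, hc, h⟩)
  · refine Or.inl ⟨σ l, c, fun x hx i j hil hjc => ?_⟩
    have hne : σ.symm i ≠ l := fun e => hil (by rw [← e, hsy])
    have := h _ ((hmem x).mp hx) (σ.symm i) j hne hjc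
    simpa [hsy] using this
  · refine Or.inr (Or.inl ⟨σ p, σ q, σ.injective.ne hpq, fun x hx j => ?_⟩)
    simpa using h _ ((hmem x).mp hx) j
  · refine Or.inr (Or.inr (Or.inl ⟨p, q, hpq, fun x hx i => ?_⟩))
    simpa [hsy] using h _ ((hmem x).mp hx) (σ.symm i)
  · refine Or.inr (Or.inr (Or.inr (Or.inl ⟨ρ.trans σ, γ, α, β, hα, hβ, fun x => ?_⟩)))
    rw [hmem x, h]
    simp only [rowPermL_apply, Equiv.trans_apply]
  · refine Or.inr (Or.inr (Or.inr (Or.inr (Or.inl ⟨ρ.trans σ, γ, c₀, hc, fun x => ?_⟩))))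
    rw [hmem x, h]
    simp only [rowPermL_apply, Equiv.trans_apply]
  · refine Or.inr (Or.inr (Or.inr (Or.inr (Or.inr (Or.inl ⟨ρ.trans σ, γ, α, β, hα, hβ, fun x => ?_⟩)))))
    rw [hmem x, h]
    simp only [rowPermL_apply, Equiv.trans_apply]
    exact and_congr (σ.surjective.forall (p := fun i => x (i, γ 0) = 0)).symm Iff.rfl
  · refine Or.inr (Or.inr (Or.inr (Or.inr (Or.inr (Or.inr ⟨ρ.trans σ, γ, c₀, hc, fun x => ?_⟩)))))
    rw [hmem x, h]
    simp only [rowPermL_apply, Equiv.trans_apply]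
    exact and_congr (σ.surjective.forall (p := fun i => x (i, γ 0) = 0)).symm Iff.rfl

/-- `Concl` pulls back along transposition (rows ↔ columns). -/
theorem concl_of_transpose {W W' : Submodule K (Fin 4 × Fin 4 → K)}
    (hmem : ∀ x, x ∈ W ↔ transposeL x ∈ W') : Concl W' → Concl W := by
  rintro (⟨l, c, h⟩ | ⟨p, q, hpq, h⟩ | ⟨p, q, hpq, h⟩ | ⟨ρ, γ, α, β, hα, hβ, h⟩ |
    ⟨ρ, γ, c₀, hc, h⟩ | ⟨ρ, γ, α, β, hα, hβ, h⟩ | ⟨ρ, γ, c₀, hc, h⟩)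
  · refine Or.inl ⟨c, l, fun x hx i j hic hjl => ?_⟩
    simpa using h _ ((hmem x).mp hx) j i hjl hic
  · refine Or.inr (Or.inr (Or.inl ⟨p, q, hpq, fun x hx i => ?_⟩))
    simpa using h _ ((hmem x).mp hx) i
  · refine Or.inr (Or.inl ⟨p, q, hpq, fun x hx j => ?_⟩)
    simpa using h _ ((hmem x).mp hx) j
  · refine Or.inr (Or.inr (Or.inr (Or.inr (Or.inr (Or.inl ⟨γ, ρ, α, β, hα, hβ, fun x => ?_⟩)))))
    rw [hmem x, h]
    simp only [transposeL_apply]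
  · refine Or.inr (Or.inr (Or.inr (Or.inr (Or.inr (Or.inr ⟨γ, ρ, c₀, hc, fun x => ?_⟩)))))
    rw [hmem x, h]
    simp only [transposeL_apply]
  · refine Or.inr (Or.inr (Or.inr (Or.inl ⟨γ, ρ, α, β, hα, hβ, fun x => ?_⟩)))
    rw [hmem x, h]
    simp only [transposeL_apply]
  · refine Or.inr (Or.inr (Or.inr (Or.inr (Or.inl ⟨γ, ρ, c₀, hc, fun x => ?_⟩))))
    rw [hmem x, h]
    simp only [transposeL_apply]

/-- Transport, zero-ROW case: move the zero row to position `0` by `Equiv.swap 0 i`. -/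
theorem transport_row [CharZero K] (hR : ResidueNorm K) (W : Submodule K (Fin 4 × Fin 4 → K))
    (hS : Sing3 W) (h6 : finrank K W = 6) (hz : ∃ i : Fin 4, ∀ x ∈ W, ∀ j : Fin 4, x (i, j) = 0) :
    Concl W := by
  obtain ⟨i, hi⟩ := hz
  have hmem := mem_iff_map_equiv (rowPermL (Equiv.swap 0 i)) W
  refine concl_of_rowPerm (Equiv.swap 0 i) hmem (hR _ ⟨sing3_map_rowPermL hS _, ?_, ?_⟩)
  · rw [LinearEquiv.finrank_map_eq]; exact h6
  · intro y hy
    obtain ⟨x, hx, rfl⟩ := Submodule.mem_map.mp hy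
    funext j
    show x (Equiv.swap 0 i 0, j) = 0
    rw [Equiv.swap_apply_left]
    exact hi x hx j

/-- **SYMMETRY TRANSPORT — PROVED** (rev 2.1; was `stub_transport`). -/
theorem transport [CharZero K] : Transport K := by
  intro hR W hS h6 hz
  rcases hz with hz | ⟨j, hj⟩
  · exact transport_row hR W hS h6 hz
  · have hmem := mem_iff_map_equiv (transposeL (K := K)) W
    refine concl_of_transpose hmem (transport_row hR _ (sing3_map_transposeL hS) ?_ ⟨j, ?_⟩)
    · rw [LinearEquiv.finrank_map_eq]; exact h6
    · intro y hy i
      obtain ⟨x, hx, rfl⟩ := Submodule.mem_map.mp hy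
      exact hj x hx i

/-! ### Kernel-checked compositions of the residue cascade -/

/-- `PureCore` from `SBShape` and `LemmaPhi`. -/
theorem pureCore_of (hS : SBShape K) (hΦ : LemmaPhi K) : PureCore K := by
  intro φ B hB h
  obtain ⟨ℓ₁, ℓ₂, hdisj, hprop⟩ := hS B hB
  refine hΦ φ ℓ₁ ℓ₂ hdisj fun u => hprop u (φ u) fun b hb l => ?_
  rw [T3_swap₁₃, T3_swap₂₃, ← T3_swap₁₃, ← T3_swap₁₂, T3_swap₂₃]
  first
  | exact h u b hb l
  | (have := h u b hb l
     simp only [T3] at this ⊢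
     linear_combination this)

omit [Field K] in
/-- Auxiliary: `fin4_of_perm` (val-idea-18, SING-SIX classification). [folklore] -/
theorem fin4_of_perm (ρ : Equiv.Perm (Fin 4)) (i : Fin 4) :
    i = ρ 0 ∨ i = ρ 1 ∨ i = ρ 2 ∨ i = ρ 3 := by
  obtain ⟨m, rfl⟩ := ρ.surjective i
  fin_cases m <;> simp

/-- Membership in the kernel plane `K_r = W ⊓ ker (rowL r)`. -/
theorem mem_kerPlane {W : Submodule K (Fin 4 × Fin 4 → K)} {r : Fin 4} {k : Fin 4 × Fin 4 → K} :
    k ∈ W ⊓ LinearMap.ker (rowL (K := K) r) ↔ k ∈ W ∧ row k r = 0 := by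
  simp [Submodule.mem_inf, LinearMap.mem_ker]

/-- `dim K_r = 2` when `n_r = 4` (rank–nullity). -/
theorem finrank_kerPlane {W : Submodule K (Fin 4 × Fin 4 → K)} (h6 : finrank K W = 6) {r : Fin 4}
    (htop : W.map (rowL r) = ⊤) : finrank K ↥(W ⊓ LinearMap.ker (rowL (K := K) r)) = 2 := by
  have hrn := LinearMap.finrank_range_add_finrank_ker ((rowL (K := K) r).domRestrict W)
  rw [LinearMap.range_domRestrict, htop, finrank_top, Module.finrank_fin_fun, h6,
    LinearMap.ker_domRestrict] at hrn
  rw [← Submodule.map_comap_subtype, Submodule.finrank_map_subtype_eq]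
  omega

end Summit.ValiantsHypothesis.ValiantsHypothesis.Theorems.SymPencilSingSixClassification

end
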